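import Literature.Analysis.FluidPDE.Tao2016AveragedNS.SplitCascadeSplitConclusionShell
import Literature.Analysis.FluidPDE.Tao2016AveragedNS.SplitCascadeWindowLevelEventually
import Literature.Analysis.FluidPDE.Tao2016AveragedNS.SplitCascadeRescaledRegime
import Literature.Analysis.FluidPDE.TaoCascadeSmallScaleOneInRegime
import Literature.Analysis.FluidPDE.TaoCascadeReducedClaimIIFromSetting
import Literature.Analysis.FluidPDE.TaoCascadeReducedClaimExit
import HarnessLib

/-!
# The split Prop. 6.5 HOLDS (`rescaledSplitStep_holds`), and hence the split Theorem 6.2♯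

T. Tao, *Finite time blowup for an averaged three-dimensional Navier–Stokes equation*, J. Amer. Math.
Soc. **29** (2016), 601–674 = arXiv:1402.0290v3, §6.4 Prop. 6.5 (regime `1 ≪ 1/ε₀ ≪ K ≪ 1/ε ≪ n₀`,
Remark 6.6), §6.5–6.7, and §6.2 Theorem 6.2.
HONEST FRAMING (cell harvest/h2-tao-ladder, rung 1 of a ladder of MODEL equations): statements about
the SPLIT cascade model ODE system (`SplitODESystem`, each squared mode of Tao's table doubled);
nothing here concerns the true Navier–Stokes equations, and nothing here is the PDE-level
Theorem 3.3♯ (the wavelet reduction of §4 is a separate statement).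

This file is the last ("`InRegime` bookkeeping") step of the split Prop. 6.5: the pointwise
`RescaledSplitHypotheses.splitConclusion_of_profile_shell` (`SplitCascadeSplitConclusionShell.lean`)
holds for ONE datum under ≈25 explicit scalar conditions; here every condition is shown to hold
"for `K` large (given `ε₀, C₃`), `ε` small (given `K`), `n₀` large (given everything)", with

* the GEOMETRIC live asymmetry profile `η(1) = ρ`, `η(0) = 4√(Awin+1)·ρ`, `η(m) = 16(Awin+1)·ρ`
  (`m ≤ -1`), `η(m) = ρ` (`m ≥ 2`), `ρ = (1+ε₀)^{-n₀/4}`, `Awin = Awin ε K` the window Grönwall factor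
  (`SplitCascadeWindowLevelBound.lean`) — a constant profile does NOT reproduce, the level must grow
  along `1 → 0 → -1`, the direction in which a shell moves at each step;
* the dormant-clock profile `β(m) = 4√2·K⁻¹⁵(1+ε₀)^{-5m}`;
* per datum, the bootstrap run with the ENLARGED error constant
  `C₁' = 2C₁ + 32768·K⁵(1+ε₀)²(ε⁻²+ε⁻¹K¹⁰+K+1)(Awin+1)³` (`RescaledSplitHypotheses.mono_C₁`), whose
  surplus absorbs the asymmetry corrections of the window (master smallness).

Results: `RescaledSplitHypotheses.splitConclusion_geometric` (pointwise, conditions in closed form),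
`InRegime.of_profile` (the regime quantifier knows the profile), `rescaledSplitStep_holds` (the split
Prop. 6.5 for the coefficient `10⁻⁵e^{-K¹⁰/2}` and these profiles), and the split Theorem 6.2♯
`noGlobalSplit_holds` (no global solution of the split cascade ODE system in Tao's regime), by the
tree's PROVED reduction `noGlobalSplit_of_rescaledSplitStepWith` (`SplitCascadeRescaled.lean`).
Theorems only.

## References

* T. Tao, J. Amer. Math. Soc. 29 (2016), 601–674 = arXiv:1402.0290v3, §6.2 Thm. 6.2, §6.4
  Prop. 6.5, Remark 6.6, §6.5–6.7. [`Tao2016AveragedNS`]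
-/

noncomputable section

open Set MeasureTheory intervalIntegral Filter
open scoped _root_.Topology

namespace Literature.Analysis.FluidPDE

namespace Tao2016AveragedNS

open TaoCascade (geomConst cumEnergyConst geomConst_pos cumEnergyConst_nonneg)

/-! ## Elementary facts about the geometric profile and the closed-form window majorants -/

section Aux

/-- `((1+ε₀)^{-n₀/4})² = (1+ε₀)^{-n₀/2}`. [folklore] -/
private theorem rpow_neg_quarter_sq {ε₀ : ℝ} (hε₀ : 0 < ε₀) (n₀ : ℤ) :
    ((1 + ε₀) ^ (-(n₀ : ℝ) / 4)) ^ 2 = (1 + ε₀) ^ (-(n₀ : ℝ) / 2) := by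
  have h0 : (0 : ℝ) ≤ 1 + ε₀ := by linarith
  rw [← Real.rpow_natCast, ← Real.rpow_mul h0]; congr 1; push_cast; ring

/-- `√(A+1)² = A+1` for `A ≥ 0`. [folklore] -/
private theorem sqrt_add_one_sq {A : ℝ} (hA : 0 ≤ A) : Real.sqrt (A + 1) ^ 2 = A + 1 :=
  Real.sq_sqrt (by linarith)

/-- `1 ≤ √(A+1) ≤ A+1` for `A ≥ 0`. [folklore] -/
private theorem one_le_sqrt_add_one {A : ℝ} (hA : 0 ≤ A) :
    1 ≤ Real.sqrt (A + 1) ∧ Real.sqrt (A + 1) ≤ A + 1 := by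
  have h1 : 1 ≤ Real.sqrt (A + 1) := Real.one_le_sqrt.2 (by linarith)
  refine ⟨h1, ?_⟩
  nlinarith [sqrt_add_one_sq hA, h1]

/-- The nested `if` of the geometric profile at `m = -1`. [folklore] -/
private theorem ite_neg_one {a b c : ℝ} :
    (if (-1 : ℤ) ≤ -1 then a else if (-1 : ℤ) = 0 then b else c) = a := by
  simp

/-- The nested `if` of the geometric profile at `m = 0`. [folklore] -/
private theorem ite_zero' {a b c : ℝ} :
    (if (0 : ℤ) ≤ -1 then a else if (0 : ℤ) = 0 then b else c) = b := by
  simp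

/-- The nested `if` of the geometric profile at `m ≥ 1`. [folklore] -/
private theorem ite_nat {a b c : ℝ} (m : ℕ) (hm : 1 ≤ m) :
    (if (m : ℤ) ≤ -1 then a else if (m : ℤ) = 0 then b else c) = c := by
  have h1 : ¬ ((m : ℤ) ≤ -1) := by omega
  have h2 : ¬ ((m : ℤ) = 0) := by omega
  simp only [h1, h2, if_false]

/-- The geometric profile is non-negative (`ε₀ > -1`). [cite: Tao2016AveragedNS, §6.4 Prop. 6.5] -/
private theorem prof_nonneg {ε₀ : ℝ} (hε₀ : -1 < ε₀) (K ε : ℝ) (n₀ : ℤ) (m : ℤ) :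
    0 ≤ (fun m : ℤ => (if m ≤ -1 then 16 * (Awin ε K + 1)
        else if m = 0 then 4 * Real.sqrt (Awin ε K + 1) else 1) * (1 + ε₀) ^ (-(n₀ : ℝ) / 4)) m := by
  have h0 : (0 : ℝ) < 1 + ε₀ := by linarith
  have hA := Awin_nonneg ε K
  have hρ : 0 < (1 + ε₀) ^ (-(n₀ : ℝ) / 4) := Real.rpow_pos_of_pos h0 _
  simp only
  split_ifs <;> positivity

/-- From the closed-form majorant of the largest live level: `windowLevel(16(A+1)ρ)² ≤ 1024(A+1)³δ`.
[cite: Tao2016AveragedNS, §6.4 Prop. 6.5] -/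
private theorem wl_sq_le {wl A ρ δ : ℝ} (hwl : 0 ≤ wl) (hA : 0 ≤ A) (hρ : ρ ^ 2 = δ)
    (he : wl ≤ 2 * Real.sqrt (A + 1) * (16 * (A + 1) * ρ)) :
    wl ^ 2 ≤ 1024 * (A + 1) ^ 3 * δ := by
  have hsq := pow_le_pow_left₀ hwl he 2
  have e : (2 * Real.sqrt (A + 1) * (16 * (A + 1) * ρ)) ^ 2 = 1024 * (A + 1) ^ 3 * δ := by
    rw [show (2 * Real.sqrt (A + 1) * (16 * (A + 1) * ρ)) ^ 2 =
      1024 * Real.sqrt (A + 1) ^ 2 * (A + 1) ^ 2 * ρ ^ 2 by ring, sqrt_add_one_sq hA, hρ]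
    ring
  rw [← e]; exact hsq

/-- From the closed-form majorant of the current shell's level: `2·windowLevel(4√(A+1)ρ) ≤ 16(A+1)ρ`.
[cite: Tao2016AveragedNS, §6.4 Prop. 6.5] -/
private theorem two_wl_le_prev {wl A ρ : ℝ} (hA : 0 ≤ A)
    (he : wl ≤ 2 * Real.sqrt (A + 1) * (4 * Real.sqrt (A + 1) * ρ)) :
    2 * wl ≤ 16 * (A + 1) * ρ := by
  calc 2 * wl ≤ 2 * (2 * Real.sqrt (A + 1) * (4 * Real.sqrt (A + 1) * ρ)) := by linarith
    _ = 16 * Real.sqrt (A + 1) ^ 2 * ρ := by ring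
    _ = 16 * (A + 1) * ρ := by rw [sqrt_add_one_sq hA]

/-- The master smallness from the enlarged error constant: `16XY·windowLevel² ≤ (C₁/2)δ` once
`windowLevel² ≤ 1024Mδ` and `32768XYM ≤ C₁`. [cite: Tao2016AveragedNS, §6.4 Prop. 6.5] -/
private theorem master_aux {X Y w M δ C : ℝ} (hX : 0 ≤ X) (hY : 0 ≤ Y) (hδ : 0 ≤ δ)
    (hw : w ≤ 1024 * M * δ) (hC : 32768 * X * Y * M ≤ C) : 16 * X * Y * w ≤ C / 2 * δ := by
  have hXY : 0 ≤ 16 * X * Y := by positivity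
  calc 16 * X * Y * w ≤ 16 * X * Y * (1024 * M * δ) := mul_le_mul_of_nonneg_left hw hXY
    _ = (32768 * X * Y * M) / 2 * δ := by ring
    _ ≤ C / 2 * δ := by gcongr

/-- The `a`-asymmetry integral condition (6.109)♯ from its closed linear-in-`δ` form.
[cite: Tao2016AveragedNS, §6.6 Prop. 6.13] -/
private theorem delta5_aux {E e B a δ k C g w M R : ℝ} (hE : 0 ≤ E) (he : 0 ≤ e) (hCg : 0 ≤ C * g)
    (hδ0 : 0 ≤ δ) (hδ1 : δ ≤ 1) (hw : w ≤ M * δ)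
    (h5 : E * (e * ((B * (a * k)) ^ 2 * C * g + 100 * M)) * δ ≤ R) :
    E * (e * ((B * (a * δ * k)) ^ 2 * C * g + 100 * w)) ≤ R := by
  refine le_trans ?_ h5
  have hsq : 0 ≤ (B * (a * k)) ^ 2 * C * g := by
    rw [mul_assoc]; exact mul_nonneg (sq_nonneg _) hCg
  have h1 : (B * (a * δ * k)) ^ 2 * C * g ≤ (B * (a * k)) ^ 2 * C * g * δ := by
    have e1 : (B * (a * δ * k)) ^ 2 * C * g = ((B * (a * k)) ^ 2 * C * g * δ) * δ := by ring
    rw [e1]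
    calc ((B * (a * k)) ^ 2 * C * g * δ) * δ ≤ ((B * (a * k)) ^ 2 * C * g * δ) * 1 :=
          mul_le_mul_of_nonneg_left hδ1 (mul_nonneg hsq hδ0)
      _ = _ := mul_one _
  have h2 : (B * (a * δ * k)) ^ 2 * C * g + 100 * w ≤ ((B * (a * k)) ^ 2 * C * g + 100 * M) * δ := by
    nlinarith [h1, hw]
  have h3 := mul_le_mul_of_nonneg_left (mul_le_mul_of_nonneg_left h2 he) hE
  calc E * (e * ((B * (a * δ * k)) ^ 2 * C * g + 100 * w))
      ≤ E * (e * (((B * (a * k)) ^ 2 * C * g + 100 * M) * δ)) := h3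
    _ = E * (e * ((B * (a * k)) ^ 2 * C * g + 100 * M)) * δ := by ring

/-- `2(√2 k q) ≤ 4√2 k q` for `√2 k q ≥ 0`. [folklore] -/
private theorem two_mul_le_four {k q : ℝ} (h : 0 ≤ Real.sqrt 2 * k * q) :
    2 * (Real.sqrt 2 * k * q) ≤ 4 * Real.sqrt 2 * k * q := by
  have e : 4 * Real.sqrt 2 * k * q = 2 * (Real.sqrt 2 * k * q) + 2 * (Real.sqrt 2 * k * q) := by ring
  rw [e]; linarith

end Aux

/-! ## The split Prop. 6.5 for one datum, with the geometric profile and closed-form conditions -/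

section Pointwise

variable {ε₀ K ε C₁ C₂ C₃ : ℝ} {n₀ N : ℤ} {ηp : ℤ → ℝ} {βp : ℕ → ℝ} {τ : ℤ → ℝ}
  {Y : Fin 4 → ℤ → ℝ → ℝ} {W : Fin 3 → ℤ → ℝ → ℝ} {F : ℤ → ℝ → ℝ}

set_option maxHeartbeats 400000 in
/-- **The split Prop. 6.5 for one datum, geometric profile, closed-form conditions.** Hypotheses at
error constant `C₁/2` whose profile IS the geometric profile (`hηp`, `hβp`); the scalar conditions are
those of `splitConclusion_of_profile_shell` with the window levels replaced by their closed-form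
majorants `2√(Awin+1)·θρ` (hypotheses `he1a`–`he1c`, each an instance of
`eventually_windowLevel_le`), plus `32768·K⁵Λ²(ε⁻²+ε⁻¹K¹⁰+K+1)(Awin+1)³ ≤ C₁` (master smallness).
Conclusion: the split conclusion with the SAME profile. [cite: Tao2016AveragedNS, §6.4 Prop. 6.5] -/
theorem RescaledSplitHypotheses.splitConclusion_geometric
    (h : RescaledSplitHypotheses (1 / 10 ^ 5 * Real.exp (-K ^ 10 / 2)) ε₀ K ε (C₁ / 2) C₂ C₃ n₀ N
      ηp βp τ Y W F)
    (hηp : ηp = fun m : ℤ => (if m ≤ -1 then 16 * (Awin ε K + 1)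
        else if m = 0 then 4 * Real.sqrt (Awin ε K + 1) else 1) * (1 + ε₀) ^ (-(n₀ : ℝ) / 4))
    (hβp : βp = fun m : ℕ => 4 * Real.sqrt 2 * (K ^ 15)⁻¹ * (1 + ε₀) ^ (-(5 : ℝ) * m))
    (hε₀ : 0 < ε₀) (hε₀1 : ε₀ < 1) (hε : 0 < ε) (hε1 : ε ≤ 1) (hC₁ : 0 ≤ C₁) (hC₂ : 0 ≤ C₂)
    (hC₃ : 0 ≤ C₃) (hN : n₀ ≤ N)
    -- `K` large (given `ε₀`, `C₃`)
    (hK18 : (10 : ℝ) ^ 18 ≤ K) (hKε : 10 ^ 8 ≤ ε₀ * K ^ 4) (hKε₀ : (10 : ℝ) ^ 6 ≤ K * ε₀)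
    (hKD : 11 * K ^ (-(1 : ℝ) / 4) ≤ 1 / (2 * 10 ^ 5))
    (hκ : 36 * Real.sqrt 2 * K * ((K ^ 15)⁻¹ * (1 + ε₀) ^ (-(999 : ℝ) / 100) * C₃ *
      geomConst ε₀ ((248 : ℝ) / 100)) ≤ 1)
    (hKa : 24 * ((K ^ 30)⁻¹ * C₃ * geomConst ε₀ ((747 : ℝ) / 100)) ≤ K ^ (-(1 : ℝ) / 4))
    (hKc : 48600 * K ^ 10 * Real.exp (-(188 / 100) * K ^ 10) * K ^ (-(1 : ℝ) / 4) *
      (C₃ * geomConst ε₀ ((741 : ℝ) / 100) + 1) ≤ 1)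
    (hKd : K ^ (-(1 : ℝ) / 4) * (3 * C₃ * geomConst ε₀ ((245 : ℝ) / 100) + 1100) < 1 / 100)
    (hKe : Real.exp (3600 * Real.sqrt 2 * (K ^ 14)⁻¹) ≤ 2)
    (hKf1 : 100 * (54 * Real.sqrt 2) * K ^ (-(1 : ℝ) / 4) * Real.exp (-(94 / 100) * K ^ 10) ≤
      1 / 2 * (K ^ 15)⁻¹)
    -- `ε` small (given `K`)
    (hεexp : ε * Real.exp (10 ^ 6 * K ^ 10) ≤ 1)
    -- `n₀` large (given `ε₀, K, ε, C₁, C₂, C₃`)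
    (hn : C₂ * (1 + ε₀) ^ (-(n₀ : ℝ) / 2) * cumEnergyConst ε₀ C₃ ≤ 1 / 100)
    (hδ1 : 4 * C₁ * (1 + ε₀) ^ (-(n₀ : ℝ) / 2) *
      (Real.exp 1 * (6 * Real.sqrt 2 * K) * cumEnergyConst ε₀ C₃ * C₃ * geomConst ε₀ ((496 : ℝ) / 100)) ≤
      ε ^ 2 * Real.exp (-K ^ 10) * K ^ (-(1 : ℝ) / 4))
    (hδ2 : 400 * C₁ * (1 + ε₀) ^ (-(n₀ : ℝ) / 2) ≤ ε ^ 2 * Real.exp (-K ^ 10) * K ^ (-(1 : ℝ) / 4))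
    (hδ3 : 400 * C₁ * (1 + ε₀) ^ (-(n₀ : ℝ) / 2) ≤ 1 / 2 * (K ^ 15)⁻¹)
    (hδ4 : Real.exp (6 / 100 * K ^ 10) * (4 * C₁ *
      (Real.exp 1 * (6 * Real.sqrt 2 * K) * cumEnergyConst ε₀ C₃ * C₃ * geomConst ε₀ ((496 : ℝ) / 100) +
        100)) * (1 + ε₀) ^ (-(n₀ : ℝ) / 2) ≤ 1 / 4 * (1 + ε₀) ^ (-(n₀ : ℝ) / 4))
    (hlate : (C₁ + C₂ + (C₂ * (1 + ε₀) ^ (2 : ℝ) * (cumEnergyConst ε₀ C₃ + 100) + C₁) + 1) *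
      (1 + ε₀) ^ (-(n₀ : ℝ) / 4) ≤ ε ^ 4 * Real.exp (-10 * K ^ 10))
    (hη0' : 4 * Real.sqrt (Awin ε K + 1) * (1 + ε₀) ^ (-(n₀ : ℝ) / 4) ≤ 1 / 10 ^ 3)
    (he1a : windowLevel ε₀ K ε (C₁ / 2) n₀ (1 * (1 + ε₀) ^ (-(n₀ : ℝ) / 4)) ≤
      2 * Real.sqrt (Awin ε K + 1) * (1 * (1 + ε₀) ^ (-(n₀ : ℝ) / 4)))
    (he1b : windowLevel ε₀ K ε (C₁ / 2) n₀
        (4 * Real.sqrt (Awin ε K + 1) * (1 + ε₀) ^ (-(n₀ : ℝ) / 4)) ≤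
      2 * Real.sqrt (Awin ε K + 1) * (4 * Real.sqrt (Awin ε K + 1) * (1 + ε₀) ^ (-(n₀ : ℝ) / 4)))
    (he1c : windowLevel ε₀ K ε (C₁ / 2) n₀ (16 * (Awin ε K + 1) * (1 + ε₀) ^ (-(n₀ : ℝ) / 4)) ≤
      2 * Real.sqrt (Awin ε K + 1) * (16 * (Awin ε K + 1) * (1 + ε₀) ^ (-(n₀ : ℝ) / 4)))
    (hZhi : 2 * (Real.exp ((ε + ε ^ 2 + 2 * (ε ^ 2)⁻¹ + ε⁻¹ * K ^ 10 + 6 * K) * Real.sqrt 2 *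
          (K ^ 15)⁻¹ * (C₃ * geomConst ε₀ ((248 : ℝ) / 100) + 100)) *
        (Real.sqrt 3 * (C₁ / 2) * (1 + ε₀) ^ (-(n₀ : ℝ) / 2) * (K ^ 15)⁻¹ *
          (C₃ * geomConst ε₀ ((248 : ℝ) / 100) + 100))) ≤ 1 * (1 + ε₀) ^ (-(n₀ : ℝ) / 4))
    (hζK' : 1024 * (Awin ε K + 1) ^ 3 * (1 + ε₀) ^ (-(n₀ : ℝ) / 2) ≤ 1 / 4 * (K ^ 20)⁻¹)
    (hmaster : 32768 * (K ^ 5 * (1 + ε₀) ^ (2 : ℝ)) * ((ε ^ 2)⁻¹ + ε⁻¹ * K ^ 10 + K + 1) *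
      (Awin ε K + 1) ^ 3 ≤ C₁)
    (hδle1 : (1 + ε₀) ^ (-(n₀ : ℝ) / 2) ≤ 1)
    (hδ5' : Real.exp (6 / 100 * K ^ 10) * (6 * ε ^ 2 * Real.exp (-K ^ 10) *
      ((Real.exp ((6 * (ε + ε ^ 2 + 2 * (ε ^ 2)⁻¹ + ε⁻¹ * K ^ 10) + 36 * K) * Real.sqrt 2 *
            ((K ^ 15)⁻¹ * C₃ * geomConst ε₀ ((248 : ℝ) / 100))) *
          ((4 * Real.sqrt 3 * (C₁ / 2)) * ((K ^ 15)⁻¹ * C₃ * geomConst ε₀ ((248 : ℝ) / 100)))) ^ 2 *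
          C₃ * geomConst ε₀ ((245 : ℝ) / 100) + 100 * (1024 * (Awin ε K + 1) ^ 3))) *
        (1 + ε₀) ^ (-(n₀ : ℝ) / 2) ≤ 1 / 4 * (1 + ε₀) ^ (-(n₀ : ℝ) / 4)) :
    ∃ τ₁ μ₁ : ℝ, RescaledSplitConclusion (1 / 10 ^ 5 * Real.exp (-K ^ 10 / 2)) ε₀ K ε n₀ ηp βp
      Y W F τ₁ μ₁ := by
  subst hηp hβp
  have h0 : (0 : ℝ) < 1 + ε₀ := by linarith only [hε₀]
  have hK0 : 0 < K := lt_of_lt_of_le (by norm_num) hK18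
  have hρ0 : 0 < (1 + ε₀) ^ (-(n₀ : ℝ) / 4) := Real.rpow_pos_of_pos h0 _
  have hδ0 : 0 < (1 + ε₀) ^ (-(n₀ : ℝ) / 2) := Real.rpow_pos_of_pos h0 _
  have hA0 : 0 ≤ Awin ε K := Awin_nonneg ε K
  have hS := one_le_sqrt_add_one hA0
  -- the profile at the checkpoint
  have hτ00 : τ (n₀ - N) ≤ 0 := h.tau_init_le hN
  have hη1s : ∀ i : Fin 3, |W i 1 0| ≤ 1 * (1 + ε₀) ^ (-(n₀ : ℝ) / 4) := fun i => by
    have := h.w_abs_le i 1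
    rw [ite_nat 1 le_rfl, Nat.cast_one] at this
    exact this
  have hη0s : ∀ i : Fin 3, |W i 0 0| ≤
      4 * Real.sqrt (Awin ε K + 1) * (1 + ε₀) ^ (-(n₀ : ℝ) / 4) := fun i => by
    have := h.w_abs_le i 0
    rw [Nat.cast_zero] at this
    rw [ite_zero'] at this
    exact this
  have hηm1s : ∀ i : Fin 3, |W i (-1) 0| ≤ 16 * (Awin ε K + 1) * (1 + ε₀) ^ (-(n₀ : ℝ) / 4) := by
    intro i
    rcases lt_or_eq_of_le hN with hlt | heq
    · have := h.w_prev_abs_le hlt i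
      rw [ite_neg_one] at this
      exact this
    · have hz : W i (-1) 0 = 0 := h.noLow_W i (-1) 0 (by omega) hτ00
      rw [hz, abs_zero]; positivity
  have h4S : 4 * Real.sqrt (Awin ε K + 1) * (1 + ε₀) ^ (-(n₀ : ℝ) / 4) ≤
      16 * (Awin ε K + 1) * (1 + ε₀) ^ (-(n₀ : ℝ) / 4) :=
    mul_le_mul_of_nonneg_right (by linarith only [hS.2, hA0]) hρ0.le
  have h1S : 1 * (1 + ε₀) ^ (-(n₀ : ℝ) / 4) ≤ 16 * (Awin ε K + 1) * (1 + ε₀) ^ (-(n₀ : ℝ) / 4) :=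
    mul_le_mul_of_nonneg_right (by linarith only [hA0]) hρ0.le
  have hη : ∀ i : Fin 3, |W i (-1) 0| ≤ 16 * (Awin ε K + 1) * (1 + ε₀) ^ (-(n₀ : ℝ) / 4) ∧
      |W i 0 0| ≤ 16 * (Awin ε K + 1) * (1 + ε₀) ^ (-(n₀ : ℝ) / 4) ∧
      |W i 1 0| ≤ 16 * (Awin ε K + 1) * (1 + ε₀) ^ (-(n₀ : ℝ) / 4) := fun i =>
    ⟨hηm1s i, (hη0s i).trans h4S, (hη1s i).trans h1S⟩
  -- the largest window level and its three uses
  have hwl : windowLevel ε₀ K ε (C₁ / 2) n₀ (16 * (Awin ε K + 1) * (1 + ε₀) ^ (-(n₀ : ℝ) / 4)) ^ 2 ≤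
      1024 * (Awin ε K + 1) ^ 3 * (1 + ε₀) ^ (-(n₀ : ℝ) / 2) :=
    wl_sq_le (windowLevel_nonneg _ _ _ _ _ _) hA0 (rpow_neg_quarter_sq hε₀ n₀) he1c
  have hζK := hwl.trans hζK'
  have hsmall : 16 * (K ^ 5 * (1 + ε₀) ^ (2 : ℝ)) * ((ε ^ 2)⁻¹ + ε⁻¹ * K ^ 10 + K + 1) *
      windowLevel ε₀ K ε (C₁ / 2) n₀ (16 * (Awin ε K + 1) * (1 + ε₀) ^ (-(n₀ : ℝ) / 4)) ^ 2 ≤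
      C₁ / 2 * (1 + ε₀) ^ (-(n₀ : ℝ) / 2) :=
    master_aux (by positivity) (by positivity) hδ0.le hwl hmaster
  have hCg : 0 ≤ C₃ * geomConst ε₀ ((245 : ℝ) / 100) :=
    mul_nonneg hC₃ (geomConst_pos hε₀ (by norm_num)).le
  have hδ5 := delta5_aux (Real.exp_pos _).le (by positivity : 0 ≤ 6 * ε ^ 2 * Real.exp (-K ^ 10)) hCg
    hδ0.le hδle1 hwl hδ5'
  -- the profile reproduces itself
  have hprev : 2 * windowLevel ε₀ K ε (C₁ / 2) n₀
        (4 * Real.sqrt (Awin ε K + 1) * (1 + ε₀) ^ (-(n₀ : ℝ) / 4)) ≤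
      (fun m : ℤ => (if m ≤ -1 then 16 * (Awin ε K + 1)
        else if m = 0 then 4 * Real.sqrt (Awin ε K + 1) else 1) * (1 + ε₀) ^ (-(n₀ : ℝ) / 4)) (-1) := by
    show _ ≤ (if (-1 : ℤ) ≤ -1 then 16 * (Awin ε K + 1)
        else if (-1 : ℤ) = 0 then 4 * Real.sqrt (Awin ε K + 1) else 1) * (1 + ε₀) ^ (-(n₀ : ℝ) / 4)
    rw [ite_neg_one]; exact two_wl_le_prev hA0 he1b
  have hzero : 2 * windowLevel ε₀ K ε (C₁ / 2) n₀ (1 * (1 + ε₀) ^ (-(n₀ : ℝ) / 4)) ≤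
      (fun m : ℤ => (if m ≤ -1 then 16 * (Awin ε K + 1)
        else if m = 0 then 4 * Real.sqrt (Awin ε K + 1) else 1) * (1 + ε₀) ^ (-(n₀ : ℝ) / 4)) 0 := by
    show _ ≤ (if (0 : ℤ) ≤ -1 then 16 * (Awin ε K + 1)
        else if (0 : ℤ) = 0 then 4 * Real.sqrt (Awin ε K + 1) else 1) * (1 + ε₀) ^ (-(n₀ : ℝ) / 4)
    rw [ite_zero']; linarith only [he1a]
  have hhi : ∀ m : ℕ, 1 ≤ m →
      2 * (Real.exp ((ε + ε ^ 2 + 2 * (ε ^ 2)⁻¹ + ε⁻¹ * K ^ 10 + 6 * K) * Real.sqrt 2 * (K ^ 15)⁻¹ *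
          (C₃ * geomConst ε₀ ((248 : ℝ) / 100) + 100)) *
        (Real.sqrt 3 * (C₁ / 2) * (1 + ε₀) ^ (-(n₀ : ℝ) / 2) * (K ^ 15)⁻¹ *
          (C₃ * geomConst ε₀ ((248 : ℝ) / 100) + 100))) ≤
      (fun m : ℤ => (if m ≤ -1 then 16 * (Awin ε K + 1)
        else if m = 0 then 4 * Real.sqrt (Awin ε K + 1) else 1) * (1 + ε₀) ^ (-(n₀ : ℝ) / 4)) m := by
    intro m hm
    show _ ≤ (if (m : ℤ) ≤ -1 then 16 * (Awin ε K + 1)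
        else if (m : ℤ) = 0 then 4 * Real.sqrt (Awin ε K + 1) else 1) * (1 + ε₀) ^ (-(n₀ : ℝ) / 4)
    rw [ite_nat m hm]
    exact hZhi
  have hβ' : ∀ m : ℕ, 1 ≤ m → 2 * (Real.sqrt 2 * (K ^ 15)⁻¹ * (1 + ε₀) ^ (-(5 : ℝ) * m)) ≤
      (fun m : ℕ => 4 * Real.sqrt 2 * (K ^ 15)⁻¹ * (1 + ε₀) ^ (-(5 : ℝ) * m)) m := by
    intro m _
    exact two_mul_le_four (by positivity)
  have hη0 : (fun m : ℤ => (if m ≤ -1 then 16 * (Awin ε K + 1)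
      else if m = 0 then 4 * Real.sqrt (Awin ε K + 1) else 1) * (1 + ε₀) ^ (-(n₀ : ℝ) / 4)) 0 ≤
      1 / 10 ^ 3 := by
    show (if (0 : ℤ) ≤ -1 then 16 * (Awin ε K + 1)
        else if (0 : ℤ) = 0 then 4 * Real.sqrt (Awin ε K + 1) else 1) * (1 + ε₀) ^ (-(n₀ : ℝ) / 4) ≤ _
    rw [ite_zero']; exact hη0'
  exact h.splitConclusion_of_profile_shell hε₀ hε₀1 hε hε1 hC₁ hC₂ hC₃ hN hK18 hKε hKε₀ hKD hκ hKa hKc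
    hKd hKe hKf1 hεexp hn hδ1 hδ2 hδ3 hδ4 hlate hη0 hη hη0s hη1s hζK hsmall hδ5
    (prof_nonneg (by linarith only [hε₀]) K ε n₀) (fun m => by positivity) hprev hzero hhi hβ'

end Pointwise

/-! ## The regime quantifier knows the profile -/

namespace InRegime

variable {γ : ℝ → ℝ} {η : ℝ → ℝ → ℝ → ℤ → ℤ → ℝ} {β : ℝ → ℝ → ℝ → ℤ → ℕ → ℝ}
  {P : SplitDatum → Prop}

/-- **Inside `InRegime γ η β` the datum's profiles ARE `η ε₀ K ε n₀` and `β ε₀ K ε n₀`**: a regime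
statement may assume the two identities. [cite: Tao2016AveragedNS, §6.4 Prop. 6.5] -/
theorem of_profile
    (h : InRegime γ η β fun D => D.η = η D.ε₀ D.K D.ε D.n₀ → D.β = β D.ε₀ D.K D.ε D.n₀ → P D) :
    InRegime γ η β P := by
  intro ε₀ hε₀ hε₀1 C₃ hC₃
  obtain ⟨K₀, hK⟩ := h ε₀ hε₀ hε₀1 C₃ hC₃
  refine ⟨K₀, fun K hK₀K hKpos => ?_⟩
  obtain ⟨e₀, he₀, hε⟩ := hK K hK₀K hKpos
  refine ⟨e₀, he₀, fun ε hεpos hεle C₁ C₂ hC₁ hC₂ => ?_⟩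
  obtain ⟨N₀, hN⟩ := hε ε hεpos hεle C₁ C₂ hC₁ hC₂
  exact ⟨N₀, fun n₀ hn₀ N hN' τ Y W F hyp => hN n₀ hn₀ N hN' τ Y W F hyp rfl rfl⟩

/-! ## The scalar conditions hold in the regime -/

/-- **The ten `K`-largeness conditions of the split Prop. 6.5 hold in the regime** (`K` large given
`ε₀, C₃`: the tree's asymptotics `eventually_*` of `TaoCascadeSmallScaleOneInRegime.lean`,
`…ReducedClaimExit.lean`, `…ReducedClaimAssembly.lean`, with `24` in place of `12` in (hKa)).
[cite: Tao2016AveragedNS, §6.4 Prop. 6.5, Remark 6.6] -/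
theorem K_conditions : InRegime γ η β fun D =>
      (10 : ℝ) ^ 18 ≤ D.K ∧
      (10 : ℝ) ^ 8 ≤ D.ε₀ * D.K ^ 4 ∧
      (10 : ℝ) ^ 6 ≤ D.K * D.ε₀ ∧
      11 * D.K ^ (-(1 : ℝ) / 4) ≤ 1 / (2 * 10 ^ 5) ∧
      36 * Real.sqrt 2 * D.K * ((D.K ^ 15)⁻¹ * (1 + D.ε₀) ^ (-(999 : ℝ) / 100) * D.C₃ * geomConst D.ε₀ ((248 : ℝ) / 100)) ≤ 1 ∧
      24 * ((D.K ^ 30)⁻¹ * D.C₃ * geomConst D.ε₀ ((747 : ℝ) / 100)) ≤ D.K ^ (-(1 : ℝ) / 4) ∧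
      48600 * D.K ^ 10 * Real.exp (-(188 / 100) * D.K ^ 10) * D.K ^ (-(1 : ℝ) / 4) * (D.C₃ * geomConst D.ε₀ ((741 : ℝ) / 100) + 1) ≤ 1 ∧
      D.K ^ (-(1 : ℝ) / 4) * (3 * D.C₃ * geomConst D.ε₀ ((245 : ℝ) / 100) + 1100) < 1 / 100 ∧
      Real.exp (3600 * Real.sqrt 2 * (D.K ^ 14)⁻¹) ≤ 2 ∧
      100 * (54 * Real.sqrt 2) * D.K ^ (-(1 : ℝ) / 4) * Real.exp (-(94 / 100) * D.K ^ 10) ≤ 1 / 2 * (D.K ^ 15)⁻¹ := by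
  refine InRegime.of_K (p := fun ε₀ C₃ K =>
      (10 : ℝ) ^ 18 ≤ K ∧
      (10 : ℝ) ^ 8 ≤ ε₀ * K ^ 4 ∧
      (10 : ℝ) ^ 6 ≤ K * ε₀ ∧
      11 * K ^ (-(1 : ℝ) / 4) ≤ 1 / (2 * 10 ^ 5) ∧
      36 * Real.sqrt 2 * K * ((K ^ 15)⁻¹ * (1 + ε₀) ^ (-(999 : ℝ) / 100) * C₃ * geomConst ε₀ ((248 : ℝ) / 100)) ≤ 1 ∧
      24 * ((K ^ 30)⁻¹ * C₃ * geomConst ε₀ ((747 : ℝ) / 100)) ≤ K ^ (-(1 : ℝ) / 4) ∧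
      48600 * K ^ 10 * Real.exp (-(188 / 100) * K ^ 10) * K ^ (-(1 : ℝ) / 4) * (C₃ * geomConst ε₀ ((741 : ℝ) / 100) + 1) ≤ 1 ∧
      K ^ (-(1 : ℝ) / 4) * (3 * C₃ * geomConst ε₀ ((245 : ℝ) / 100) + 1100) < 1 / 100 ∧
      Real.exp (3600 * Real.sqrt 2 * (K ^ 14)⁻¹) ≤ 2 ∧
      100 * (54 * Real.sqrt 2) * K ^ (-(1 : ℝ) / 4) * Real.exp (-(94 / 100) * K ^ 10) ≤ 1 / 2 * (K ^ 15)⁻¹) fun ε₀ C₃ hε₀ _ _ => ?_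
  filter_upwards [eventually_ge_atTop ((10 : ℝ) ^ 18), TaoCascade.eventually_le_eps_mul_pow_four hε₀,
    (tendsto_id.atTop_mul_const hε₀).eventually_ge_atTop ((10 : ℝ) ^ 6),
    TaoCascade.eventually_eleven_mul_rpow_neg_quarter_le,
    TaoCascade.eventually_mul_K_mul_inv_pow_fifteen_le (36 * Real.sqrt 2)
      ((1 + ε₀) ^ (-(999 : ℝ) / 100) * C₃ * geomConst ε₀ ((248 : ℝ) / 100)),
    TaoCascade.eventually_mul_inv_pow_thirty_le_rpow (24 * (C₃ * geomConst ε₀ ((747 : ℝ) / 100))),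
    TaoCascade.eventually_pow_ten_mul_exp_neg_le (48600 * (C₃ * geomConst ε₀ ((741 : ℝ) / 100) + 1)),
    TaoCascade.eventually_rpow_neg_quarter_mul_lt (3 * C₃ * geomConst ε₀ ((245 : ℝ) / 100) + 1100),
    TaoCascade.eventually_exp_mul_inv_pow_le_two (3600 * Real.sqrt 2),
    TaoCascade.eventually_rpow_mul_exp_neg_le_inv_pow (100 * (54 * Real.sqrt 2))]
    with K h1 h2 h3 h4 h5 h6 h7 h8 h9 h10
  refine ⟨h1, h2, h3, h4, ?_, ?_, ?_, h8, h9, h10⟩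
  · calc 36 * Real.sqrt 2 * K * ((K ^ 15)⁻¹ * (1 + ε₀) ^ (-(999 : ℝ) / 100) * C₃ *
          geomConst ε₀ ((248 : ℝ) / 100))
        = 36 * Real.sqrt 2 * K * ((K ^ 15)⁻¹ * ((1 + ε₀) ^ (-(999 : ℝ) / 100) * C₃ *
          geomConst ε₀ ((248 : ℝ) / 100))) := by ring
      _ ≤ 1 := h5
  · calc 24 * ((K ^ 30)⁻¹ * C₃ * geomConst ε₀ ((747 : ℝ) / 100))
        = 24 * (C₃ * geomConst ε₀ ((747 : ℝ) / 100)) * (K ^ 30)⁻¹ := by ring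
      _ ≤ K ^ (-(1 : ℝ) / 4) := h6
  · calc 48600 * K ^ 10 * Real.exp (-(188 / 100) * K ^ 10) * K ^ (-(1 : ℝ) / 4) *
          (C₃ * geomConst ε₀ ((741 : ℝ) / 100) + 1)
        = 48600 * (C₃ * geomConst ε₀ ((741 : ℝ) / 100) + 1) * K ^ 10 *
          Real.exp (-(188 / 100) * K ^ 10) * K ^ (-(1 : ℝ) / 4) := by ring
      _ ≤ 1 := h7

/-- **The two `ε`-smallness conditions hold in the regime** (`ε` small given `K`).
[cite: Tao2016AveragedNS, §6.4 Prop. 6.5, Remark 6.6] -/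
theorem eps_conditions : InRegime γ η β fun D =>
      D.ε ≤ 1 ∧
      D.ε * Real.exp (10 ^ 6 * D.K ^ 10) ≤ 1 := by
  refine InRegime.of_eps (p := fun _ _ K ε => ε ≤ 1 ∧
 ε * Real.exp (10 ^ 6 * K ^ 10) ≤ 1) fun _ _ K _ _ _ _ => ?_
  have h1 : ∀ᶠ ε in 𝓝[>] (0 : ℝ), ε ≤ 1 := by
    have : Iio (1 : ℝ) ∈ 𝓝[>] (0 : ℝ) := mem_nhdsWithin_of_mem_nhds (Iio_mem_nhds (by norm_num))
    exact Filter.mem_of_superset this fun ε (hε : ε < 1) => (le_of_lt hε : ε ≤ 1)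
  exact h1.and (TaoCascade.eventually_nhdsGT_mul_exp_le_one _)

/-- **The fourteen `n₀`-largeness conditions hold in the regime** (`n₀` large given
`ε₀, K, ε, C₁, C₂, C₃`), stated for the enlarged error constant
`C = 2C₁ + 32768·K⁵Λ²(ε⁻²+ε⁻¹K¹⁰+K+1)(Awin+1)³`: every condition is `A·(1+ε₀)^{-n₀/2} ≤ δ`,
`A·(1+ε₀)^{-n₀/2} ≤ δ(1+ε₀)^{-n₀/4}`, `A·(1+ε₀)^{-n₀/4} ≤ δ`, or the window-level reproduction
`eventually_windowLevel_le`. [cite: Tao2016AveragedNS, §6.4 Prop. 6.5, Remark 6.6] -/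
theorem n0_conditions : InRegime γ η β fun D => ∀ C : ℝ, C = 2 * D.C₁ + 32768 * (D.K ^ 5 * (1 + D.ε₀) ^ (2 : ℝ)) * ((D.ε ^ 2)⁻¹ + D.ε⁻¹ * D.K ^ 10 + D.K + 1) * (Awin D.ε D.K + 1) ^ 3 →
      D.C₂ * (1 + D.ε₀) ^ (-(D.n₀ : ℝ) / 2) * cumEnergyConst D.ε₀ D.C₃ ≤ 1 / 100 ∧
      4 * C * (1 + D.ε₀) ^ (-(D.n₀ : ℝ) / 2) * (Real.exp 1 * (6 * Real.sqrt 2 * D.K) * cumEnergyConst D.ε₀ D.C₃ * D.C₃ * geomConst D.ε₀ ((496 : ℝ) / 100)) ≤ D.ε ^ 2 * Real.exp (-D.K ^ 10) * D.K ^ (-(1 : ℝ) / 4) ∧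
      400 * C * (1 + D.ε₀) ^ (-(D.n₀ : ℝ) / 2) ≤ D.ε ^ 2 * Real.exp (-D.K ^ 10) * D.K ^ (-(1 : ℝ) / 4) ∧
      400 * C * (1 + D.ε₀) ^ (-(D.n₀ : ℝ) / 2) ≤ 1 / 2 * (D.K ^ 15)⁻¹ ∧
      Real.exp (6 / 100 * D.K ^ 10) * (4 * C * (Real.exp 1 * (6 * Real.sqrt 2 * D.K) * cumEnergyConst D.ε₀ D.C₃ * D.C₃ * geomConst D.ε₀ ((496 : ℝ) / 100) + 100)) * (1 + D.ε₀) ^ (-(D.n₀ : ℝ) / 2) ≤ 1 / 4 * (1 + D.ε₀) ^ (-(D.n₀ : ℝ) / 4) ∧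
      (C + D.C₂ + (D.C₂ * (1 + D.ε₀) ^ (2 : ℝ) * (cumEnergyConst D.ε₀ D.C₃ + 100) + C) + 1) * (1 + D.ε₀) ^ (-(D.n₀ : ℝ) / 4) ≤ D.ε ^ 4 * Real.exp (-10 * D.K ^ 10) ∧
      4 * Real.sqrt (Awin D.ε D.K + 1) * (1 + D.ε₀) ^ (-(D.n₀ : ℝ) / 4) ≤ 1 / 10 ^ 3 ∧
      windowLevel D.ε₀ D.K D.ε (C / 2) D.n₀ (1 * (1 + D.ε₀) ^ (-(D.n₀ : ℝ) / 4)) ≤ 2 * Real.sqrt (Awin D.ε D.K + 1) * (1 * (1 + D.ε₀) ^ (-(D.n₀ : ℝ) / 4)) ∧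
      windowLevel D.ε₀ D.K D.ε (C / 2) D.n₀ (4 * Real.sqrt (Awin D.ε D.K + 1) * (1 + D.ε₀) ^ (-(D.n₀ : ℝ) / 4)) ≤ 2 * Real.sqrt (Awin D.ε D.K + 1) * (4 * Real.sqrt (Awin D.ε D.K + 1) * (1 + D.ε₀) ^ (-(D.n₀ : ℝ) / 4)) ∧
      windowLevel D.ε₀ D.K D.ε (C / 2) D.n₀ (16 * (Awin D.ε D.K + 1) * (1 + D.ε₀) ^ (-(D.n₀ : ℝ) / 4)) ≤ 2 * Real.sqrt (Awin D.ε D.K + 1) * (16 * (Awin D.ε D.K + 1) * (1 + D.ε₀) ^ (-(D.n₀ : ℝ) / 4)) ∧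
      2 * (Real.exp ((D.ε + D.ε ^ 2 + 2 * (D.ε ^ 2)⁻¹ + D.ε⁻¹ * D.K ^ 10 + 6 * D.K) * Real.sqrt 2 * (D.K ^ 15)⁻¹ * (D.C₃ * geomConst D.ε₀ ((248 : ℝ) / 100) + 100)) * (Real.sqrt 3 * (C / 2) * (1 + D.ε₀) ^ (-(D.n₀ : ℝ) / 2) * (D.K ^ 15)⁻¹ * (D.C₃ * geomConst D.ε₀ ((248 : ℝ) / 100) + 100))) ≤ 1 * (1 + D.ε₀) ^ (-(D.n₀ : ℝ) / 4) ∧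
      1024 * (Awin D.ε D.K + 1) ^ 3 * (1 + D.ε₀) ^ (-(D.n₀ : ℝ) / 2) ≤ 1 / 4 * (D.K ^ 20)⁻¹ ∧
      (1 + D.ε₀) ^ (-(D.n₀ : ℝ) / 2) ≤ 1 ∧
      Real.exp (6 / 100 * D.K ^ 10) * (6 * D.ε ^ 2 * Real.exp (-D.K ^ 10) * ((Real.exp ((6 * (D.ε + D.ε ^ 2 + 2 * (D.ε ^ 2)⁻¹ + D.ε⁻¹ * D.K ^ 10) + 36 * D.K) * Real.sqrt 2 * ((D.K ^ 15)⁻¹ * D.C₃ * geomConst D.ε₀ ((248 : ℝ) / 100))) * ((4 * Real.sqrt 3 * (C / 2)) * ((D.K ^ 15)⁻¹ * D.C₃ * geomConst D.ε₀ ((248 : ℝ) / 100)))) ^ 2 * D.C₃ * geomConst D.ε₀ ((245 : ℝ) / 100) + 100 * (1024 * (Awin D.ε D.K + 1) ^ 3))) * (1 + D.ε₀) ^ (-(D.n₀ : ℝ) / 2) ≤ 1 / 4 * (1 + D.ε₀) ^ (-(D.n₀ : ℝ) / 4) := by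
  refine InRegime.of_n0 (p := fun ε₀ K ε C₁ C₂ C₃ n₀ => ∀ C : ℝ, C = 2 * C₁ + 32768 * (K ^ 5 * (1 + ε₀) ^ (2 : ℝ)) * ((ε ^ 2)⁻¹ + ε⁻¹ * K ^ 10 + K + 1) * (Awin ε K + 1) ^ 3 →
      C₂ * (1 + ε₀) ^ (-(n₀ : ℝ) / 2) * cumEnergyConst ε₀ C₃ ≤ 1 / 100 ∧
      4 * C * (1 + ε₀) ^ (-(n₀ : ℝ) / 2) * (Real.exp 1 * (6 * Real.sqrt 2 * K) * cumEnergyConst ε₀ C₃ * C₃ * geomConst ε₀ ((496 : ℝ) / 100)) ≤ ε ^ 2 * Real.exp (-K ^ 10) * K ^ (-(1 : ℝ) / 4) ∧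
      400 * C * (1 + ε₀) ^ (-(n₀ : ℝ) / 2) ≤ ε ^ 2 * Real.exp (-K ^ 10) * K ^ (-(1 : ℝ) / 4) ∧
      400 * C * (1 + ε₀) ^ (-(n₀ : ℝ) / 2) ≤ 1 / 2 * (K ^ 15)⁻¹ ∧
      Real.exp (6 / 100 * K ^ 10) * (4 * C * (Real.exp 1 * (6 * Real.sqrt 2 * K) * cumEnergyConst ε₀ C₃ * C₃ * geomConst ε₀ ((496 : ℝ) / 100) + 100)) * (1 + ε₀) ^ (-(n₀ : ℝ) / 2) ≤ 1 / 4 * (1 + ε₀) ^ (-(n₀ : ℝ) / 4) ∧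
      (C + C₂ + (C₂ * (1 + ε₀) ^ (2 : ℝ) * (cumEnergyConst ε₀ C₃ + 100) + C) + 1) * (1 + ε₀) ^ (-(n₀ : ℝ) / 4) ≤ ε ^ 4 * Real.exp (-10 * K ^ 10) ∧
      4 * Real.sqrt (Awin ε K + 1) * (1 + ε₀) ^ (-(n₀ : ℝ) / 4) ≤ 1 / 10 ^ 3 ∧
      windowLevel ε₀ K ε (C / 2) n₀ (1 * (1 + ε₀) ^ (-(n₀ : ℝ) / 4)) ≤ 2 * Real.sqrt (Awin ε K + 1) * (1 * (1 + ε₀) ^ (-(n₀ : ℝ) / 4)) ∧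
      windowLevel ε₀ K ε (C / 2) n₀ (4 * Real.sqrt (Awin ε K + 1) * (1 + ε₀) ^ (-(n₀ : ℝ) / 4)) ≤ 2 * Real.sqrt (Awin ε K + 1) * (4 * Real.sqrt (Awin ε K + 1) * (1 + ε₀) ^ (-(n₀ : ℝ) / 4)) ∧
      windowLevel ε₀ K ε (C / 2) n₀ (16 * (Awin ε K + 1) * (1 + ε₀) ^ (-(n₀ : ℝ) / 4)) ≤ 2 * Real.sqrt (Awin ε K + 1) * (16 * (Awin ε K + 1) * (1 + ε₀) ^ (-(n₀ : ℝ) / 4)) ∧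
      2 * (Real.exp ((ε + ε ^ 2 + 2 * (ε ^ 2)⁻¹ + ε⁻¹ * K ^ 10 + 6 * K) * Real.sqrt 2 * (K ^ 15)⁻¹ * (C₃ * geomConst ε₀ ((248 : ℝ) / 100) + 100)) * (Real.sqrt 3 * (C / 2) * (1 + ε₀) ^ (-(n₀ : ℝ) / 2) * (K ^ 15)⁻¹ * (C₃ * geomConst ε₀ ((248 : ℝ) / 100) + 100))) ≤ 1 * (1 + ε₀) ^ (-(n₀ : ℝ) / 4) ∧
      1024 * (Awin ε K + 1) ^ 3 * (1 + ε₀) ^ (-(n₀ : ℝ) / 2) ≤ 1 / 4 * (K ^ 20)⁻¹ ∧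
      (1 + ε₀) ^ (-(n₀ : ℝ) / 2) ≤ 1 ∧
      Real.exp (6 / 100 * K ^ 10) * (6 * ε ^ 2 * Real.exp (-K ^ 10) * ((Real.exp ((6 * (ε + ε ^ 2 + 2 * (ε ^ 2)⁻¹ + ε⁻¹ * K ^ 10) + 36 * K) * Real.sqrt 2 * ((K ^ 15)⁻¹ * C₃ * geomConst ε₀ ((248 : ℝ) / 100))) * ((4 * Real.sqrt 3 * (C / 2)) * ((K ^ 15)⁻¹ * C₃ * geomConst ε₀ ((248 : ℝ) / 100)))) ^ 2 * C₃ * geomConst ε₀ ((245 : ℝ) / 100) + 100 * (1024 * (Awin ε K + 1) ^ 3))) * (1 + ε₀) ^ (-(n₀ : ℝ) / 2) ≤ 1 / 4 * (1 + ε₀) ^ (-(n₀ : ℝ) / 4))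
    fun ε₀ K ε C₁ C₂ C₃ hε₀ _ hK hε hC₁ _ _ => ?_
  set C : ℝ := 2 * C₁ + 32768 * (K ^ 5 * (1 + ε₀) ^ (2 : ℝ)) * ((ε ^ 2)⁻¹ + ε⁻¹ * K ^ 10 + K + 1) * (Awin ε K + 1) ^ 3 with hCdef
  have hq : (0 : ℝ) < 1 / 4 := by norm_num
  have hA1 : 0 < Awin ε K + 1 := by linarith [Awin_nonneg ε K]
  have hθb : 0 < 4 * Real.sqrt (Awin ε K + 1) := mul_pos (by norm_num) (Real.sqrt_pos.2 hA1)
  have hθc : 0 < 16 * (Awin ε K + 1) := by linarith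
  -- (1) hn
  have e1 := TaoCascade.eventually_mul_rpow_neg_half_le hε₀ (C₂ * cumEnergyConst ε₀ C₃)
    (by norm_num : (0 : ℝ) < 1 / 100)
  -- (2) hδ1
  have e2 := TaoCascade.eventually_mul_rpow_neg_half_le hε₀
    (4 * C * (Real.exp 1 * (6 * Real.sqrt 2 * K) * cumEnergyConst ε₀ C₃ * C₃ *
      geomConst ε₀ ((496 : ℝ) / 100)))
    (by positivity : (0 : ℝ) < ε ^ 2 * Real.exp (-K ^ 10) * K ^ (-(1 : ℝ) / 4))
  -- (3) hδ2, (4) hδ3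
  have e3 := TaoCascade.eventually_mul_rpow_neg_half_le hε₀ (400 * C)
    (by positivity : (0 : ℝ) < ε ^ 2 * Real.exp (-K ^ 10) * K ^ (-(1 : ℝ) / 4))
  have e4 := TaoCascade.eventually_mul_rpow_neg_half_le hε₀ (400 * C)
    (by positivity : (0 : ℝ) < 1 / 2 * (K ^ 15)⁻¹)
  -- (5) hδ4
  have e5 := TaoCascade.eventually_mul_rpow_neg_half_le_mul_rpow_neg_quarter hε₀
    (Real.exp (6 / 100 * K ^ 10) * (4 * C * (Real.exp 1 * (6 * Real.sqrt 2 * K) *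
      cumEnergyConst ε₀ C₃ * C₃ * geomConst ε₀ ((496 : ℝ) / 100) + 100))) hq
  -- (6) hlate
  have e6 := TaoCascade.eventually_mul_rpow_neg_quarter_le hε₀
    ((C + C₂ + (C₂ * (1 + ε₀) ^ (2 : ℝ) * (cumEnergyConst ε₀ C₃ + 100) + C) + 1))
    (by positivity : (0 : ℝ) < ε ^ 4 * Real.exp (-10 * K ^ 10))
  -- (7) hη0'
  have e7 := TaoCascade.eventually_mul_rpow_neg_quarter_le hε₀ (4 * Real.sqrt (Awin ε K + 1))
    (by norm_num : (0 : ℝ) < 1 / 10 ^ 3)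
  -- (8)–(10) the window levels
  have e8 := eventually_windowLevel_le (C₁ := C / 2) hε₀ hε hK.le one_pos
  have e9 := eventually_windowLevel_le (C₁ := C / 2) hε₀ hε hK.le hθb
  have e10 := eventually_windowLevel_le (C₁ := C / 2) hε₀ hε hK.le hθc
  -- (11) hZhi
  have e11 := TaoCascade.eventually_mul_rpow_neg_half_le_mul_rpow_neg_quarter hε₀
    (2 * (Real.exp ((ε + ε ^ 2 + 2 * (ε ^ 2)⁻¹ + ε⁻¹ * K ^ 10 + 6 * K) * Real.sqrt 2 *
      (K ^ 15)⁻¹ * (C₃ * geomConst ε₀ ((248 : ℝ) / 100) + 100)) *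
      (Real.sqrt 3 * (C / 2) * (K ^ 15)⁻¹ * (C₃ * geomConst ε₀ ((248 : ℝ) / 100) + 100)))) one_pos
  -- (12) hζK'
  have e12 := TaoCascade.eventually_mul_rpow_neg_half_le hε₀ (1024 * (Awin ε K + 1) ^ 3)
    (by positivity : (0 : ℝ) < 1 / 4 * (K ^ 20)⁻¹)
  -- (14) hδ5'
  have e14 := TaoCascade.eventually_mul_rpow_neg_half_le_mul_rpow_neg_quarter hε₀
    (Real.exp (6 / 100 * K ^ 10) * (6 * ε ^ 2 * Real.exp (-K ^ 10) *
      ((Real.exp ((6 * (ε + ε ^ 2 + 2 * (ε ^ 2)⁻¹ + ε⁻¹ * K ^ 10) + 36 * K) * Real.sqrt 2 *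
        ((K ^ 15)⁻¹ * C₃ * geomConst ε₀ ((248 : ℝ) / 100))) *
        ((4 * Real.sqrt 3 * (C / 2)) * ((K ^ 15)⁻¹ * C₃ * geomConst ε₀ ((248 : ℝ) / 100)))) ^ 2 *
        C₃ * geomConst ε₀ ((245 : ℝ) / 100) + 100 * (1024 * (Awin ε K + 1) ^ 3)))) hq
  filter_upwards [e1, e2, e3, e4, e5, e6, e7, e8, e9, e10, e11, e12, eventually_ge_atTop (0 : ℤ), e14]
    with n₀ h1 h2 h3 h4 h5 h6 h7 h8 h9 h10 h11 h12 h13 h14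
  rintro C' rfl
  have hq1 : (1 : ℝ) ≤ 1 + ε₀ := by linarith
  refine ⟨?_, ?_, h3, h4, h5, h6, h7, h8, h9, h10, ?_, h12, ?_, h14⟩
  · calc C₂ * (1 + ε₀) ^ (-(n₀ : ℝ) / 2) * cumEnergyConst ε₀ C₃
        = C₂ * cumEnergyConst ε₀ C₃ * (1 + ε₀) ^ (-(n₀ : ℝ) / 2) := by ring
      _ ≤ 1 / 100 := h1
  · calc 4 * C * (1 + ε₀) ^ (-(n₀ : ℝ) / 2) * (Real.exp 1 * (6 * Real.sqrt 2 * K) *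
          cumEnergyConst ε₀ C₃ * C₃ * geomConst ε₀ ((496 : ℝ) / 100))
        = 4 * C * (Real.exp 1 * (6 * Real.sqrt 2 * K) * cumEnergyConst ε₀ C₃ * C₃ *
          geomConst ε₀ ((496 : ℝ) / 100)) * (1 + ε₀) ^ (-(n₀ : ℝ) / 2) := by ring
      _ ≤ _ := h2
  · calc 2 * (Real.exp ((ε + ε ^ 2 + 2 * (ε ^ 2)⁻¹ + ε⁻¹ * K ^ 10 + 6 * K) * Real.sqrt 2 *
          (K ^ 15)⁻¹ * (C₃ * geomConst ε₀ ((248 : ℝ) / 100) + 100)) *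
          (Real.sqrt 3 * (C / 2) * (1 + ε₀) ^ (-(n₀ : ℝ) / 2) * (K ^ 15)⁻¹ *
            (C₃ * geomConst ε₀ ((248 : ℝ) / 100) + 100)))
        = 2 * (Real.exp ((ε + ε ^ 2 + 2 * (ε ^ 2)⁻¹ + ε⁻¹ * K ^ 10 + 6 * K) * Real.sqrt 2 *
          (K ^ 15)⁻¹ * (C₃ * geomConst ε₀ ((248 : ℝ) / 100) + 100)) *
          (Real.sqrt 3 * (C / 2) * (K ^ 15)⁻¹ * (C₃ * geomConst ε₀ ((248 : ℝ) / 100) + 100))) *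
          (1 + ε₀) ^ (-(n₀ : ℝ) / 2) := by ring
      _ ≤ _ := h11
  · have h0n : (0 : ℝ) ≤ (n₀ : ℝ) := by exact_mod_cast h13
    exact Real.rpow_le_one_of_one_le_of_nonpos hq1 (by linarith)

end InRegime

/-! ## The split Prop. 6.5 and the split Theorem 6.2♯ -/

/-- **The split Prop. 6.5 HOLDS** for the author-corrected `X₃`-coefficient `10⁻⁵e^{-K¹⁰/2}`, the
geometric live asymmetry profile `η` (levels `16(Awin+1)ρ, 4√(Awin+1)ρ, ρ, ρ, …` on shells
`-1, 0, 1, 2, …`, `ρ = (1+ε₀)^{-n₀/4}`) and the dormant-clock profile `β(m) = 4√2K⁻¹⁵(1+ε₀)^{-5m}`: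
the cell's residual of record `rescaledSplitStepWith γ η β` (p487601) discharged.
[cite: Tao2016AveragedNS, §6.4 Prop. 6.5; §6.5–6.7] -/
theorem rescaledSplitStep_holds :
    rescaledSplitStepWith (fun K => 1 / 10 ^ 5 * Real.exp (-K ^ 10 / 2))
      (fun ε₀ K ε n₀ m => (if m ≤ -1 then 16 * (Awin ε K + 1)
        else if m = 0 then 4 * Real.sqrt (Awin ε K + 1) else 1) * (1 + ε₀) ^ (-(n₀ : ℝ) / 4))
      (fun ε₀ K _ _ m => 4 * Real.sqrt 2 * (K ^ 15)⁻¹ * (1 + ε₀) ^ (-(5 : ℝ) * m)) := by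
  rw [rescaledSplitStepWith_iff_inRegime]
  refine InRegime.of_profile
    (((InRegime.K_conditions.and InRegime.eps_conditions).and InRegime.n0_conditions).mono ?_)
  rintro D hD ⟨⟨⟨hK18, hKε, hKε₀, hKD, hκ, hKa, hKc, hKd, hKe, hKf1⟩, hε1, hεexp⟩, hN⟩ hηD hβD
  obtain ⟨hn, hδ1, hδ2, hδ3, hδ4, hlate, hη0', he1a, he1b, he1c, hZhi, hζK', hδle1, hδ5'⟩ := hN _ rfl
  have hA1 : 0 ≤ Awin D.ε D.K + 1 := by linarith [Awin_nonneg D.ε D.K]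
  have hε₀' : (-1 : ℝ) < D.ε₀ := by linarith [hD.ε₀_pos]
  have h1e : (0 : ℝ) < 1 + D.ε₀ := by linarith [hD.ε₀_pos]
  have hA0 : 0 ≤ Awin D.ε D.K := Awin_nonneg _ _
  have hKp := hD.K_pos
  have hεp := hD.ε_pos
  have hZ : 0 ≤ 32768 * (D.K ^ 5 * (1 + D.ε₀) ^ (2 : ℝ)) * ((D.ε ^ 2)⁻¹ + D.ε⁻¹ * D.K ^ 10 + D.K + 1) * (Awin D.ε D.K + 1) ^ 3 :=
    mul_nonneg (mul_nonneg (mul_nonneg (by norm_num) (mul_nonneg (pow_nonneg hKp.le 5)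
      (Real.rpow_pos_of_pos h1e _).le)) (by positivity)) (pow_nonneg (by linarith) 3)
  have hC : D.C₁ ≤ (2 * D.C₁ + 32768 * (D.K ^ 5 * (1 + D.ε₀) ^ (2 : ℝ)) * ((D.ε ^ 2)⁻¹ + D.ε⁻¹ * D.K ^ 10 + D.K + 1) * (Awin D.ε D.K + 1) ^ 3) / 2 := by
    linarith
  have hC0 : 0 ≤ 2 * D.C₁ + 32768 * (D.K ^ 5 * (1 + D.ε₀) ^ (2 : ℝ)) * ((D.ε ^ 2)⁻¹ + D.ε⁻¹ * D.K ^ 10 + D.K + 1) * (Awin D.ε D.K + 1) ^ 3 := by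
    linarith [hD.C₁_nonneg]
  have hmaster : 32768 * (D.K ^ 5 * (1 + D.ε₀) ^ (2 : ℝ)) * ((D.ε ^ 2)⁻¹ + D.ε⁻¹ * D.K ^ 10 + D.K + 1) * (Awin D.ε D.K + 1) ^ 3 ≤
      2 * D.C₁ + 32768 * (D.K ^ 5 * (1 + D.ε₀) ^ (2 : ℝ)) * ((D.ε ^ 2)⁻¹ + D.ε⁻¹ * D.K ^ 10 + D.K + 1) * (Awin D.ε D.K + 1) ^ 3 := by linarith [hD.C₁_nonneg]
  exact (hD.hyp.mono_C₁ hε₀' hC).splitConclusion_geometric hηD hβD hD.ε₀_pos hD.ε₀_lt_one hD.ε_pos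
    hε1 hC0 hD.C₂_nonneg hD.C₃_nonneg hD.n₀_le_N hK18 hKε hKε₀ hKD hκ hKa hKc hKd hKe hKf1 hεexp hn
    hδ1 hδ2 hδ3 hδ4 hlate hη0' he1a he1b he1c hZhi hζK' hmaster hδle1 hδ5'

/-- **The split Theorem 6.2♯ (PROVED): no global solution of the split cascade ODE system in Tao's
regime.** For every `0 < ε₀ < 1`, for `K` sufficiently large, `ε` sufficiently small, all error
constants `C₁, C₂ ≥ 0` and `n₀` sufficiently large, there is no global `SplitODESystem ε₀ K ε C₁ C₂ n₀`
(Tao's (6.1)–(6.10) for the table with every squared mode doubled and the two-copy datum). From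
`rescaledSplitStep_holds` by the tree's reduction `noGlobalSplit_of_rescaledSplitStepWith`
(Prop. 6.5♯ ⇒ Prop. 6.4♯ ⇒ Thm. 6.2♯). MODEL statement; nothing about Navier–Stokes.
[cite: Tao2016AveragedNS, §6.2 Thm. 6.2, §6.4] -/
theorem noGlobalSplit_holds :
    ∀ ε₀ : ℝ, 0 < ε₀ → ε₀ < 1 →
      ∃ K₀ : ℝ, ∀ K : ℝ, K₀ ≤ K → 0 < K →
        ∃ e₀ : ℝ, 0 < e₀ ∧ ∀ ε : ℝ, 0 < ε → ε ≤ e₀ →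
          ∀ C₁ C₂ : ℝ, 0 ≤ C₁ → 0 ≤ C₂ →
            ∃ N₀ : ℤ, ∀ n₀ : ℤ, N₀ ≤ n₀ →
              ¬ ∃ (S : Fin 4 → ℤ → ℝ → ℝ) (Z : Fin 3 → ℤ → ℝ → ℝ) (E : ℤ → ℝ → ℝ),
                SplitODESystem ε₀ K ε C₁ C₂ n₀ S Z E := by
  have h := splitBlowupDynamicsStepWith_of_rescaledSplitStepWith rescaledSplitStep_holds
  intro ε₀ hε₀ hε₀1
  obtain ⟨K₀, hK⟩ := h ε₀ hε₀ hε₀1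
  refine ⟨K₀, fun K hK₀K hKpos => ?_⟩
  obtain ⟨e₀, he₀, hε⟩ := hK K hK₀K hKpos
  refine ⟨e₀, he₀, fun ε hεpos hεle C₁ C₂ hC₁ hC₂ => ?_⟩
  obtain ⟨N₀, hN⟩ := hε ε hεpos hεle C₁ C₂ hC₁ hC₂
  refine ⟨N₀, fun n₀ hn₀ => ?_⟩
  rintro ⟨S, Z, E, hsol⟩
  have hγ : (0 : ℝ) ≤ 1 / 10 ^ 5 * Real.exp (-K ^ 10 / 2) := by positivity
  have hε₀' : (-1 : ℝ) < ε₀ := by linarith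
  have h0 : (0 : ℝ) < 1 + ε₀ := by linarith
  have hβ0 : ∀ m : ℕ, (0 : ℝ) ≤ 4 * Real.sqrt 2 * (K ^ 15)⁻¹ * (1 + ε₀) ^ (-(5 : ℝ) * m) :=
    fun m => mul_nonneg (by positivity) (Real.rpow_pos_of_pos h0 _).le
  exact hsol.false_of_inductiveStepWith hγ hε₀ hKpos hεpos _
    (hsol.splitAsymmetryProfile_base (prof_nonneg hε₀' K ε n₀) hβ0) (hN n₀ hn₀ S Z E hsol)

end Tao2016AveragedNS

end Literature.Analysis.FluidPDE
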